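import Mathlib
import Literature.Geometry.Lorentzian.KerrSurfaceGravity
import Literature.Geometry.Lorentzian.KerrSeparatedPotential
import Summits.FinalStateConjecture.FinalStateConjecture.Theses.PhaseMixingCapture

/-!
# Sketch — crux-ideate, crux `NearExtremalKappaCapture` (stmt-FinalStateConjecture-10606), ideator 2, round 1

First lemmas of three idea cards — ALL PROVED (rc 0, no `sorry`; axioms standard):

* card `polynomial-in-polynomial-out`     → `firstLemma_newtonKantorovich`, `basin_exponent_compose`
* card `area-buys-margin`                  → `margin_monotone`, `margin_at_kerr`, `firstLemma_areaPinsTemperature`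
* card `temperature-is-gauge-in-the-throat` → `delta_zoom`, `nearNHEK_scaling`, `gamma_is_boost_weight`

Constants used (all `lean search --decl`-verified): `Kerr.rPlus`, `Kerr.rMinus`, `Kerr.IsSubextremal`,
`Kerr.delta`, `Kerr.delta_eq_mul`, `Kerr.rPlus_sub_rMinus`, `Kerr.surfaceGravity`,
`Summit.FinalStateConjecture.FinalStateConjecture.Theses.PhaseMixingCapture.NearExtremalKappaCapture`.
-/

noncomputable section

open Set Filter Topology

namespace Summit.FinalStateConjecture.FinalStateConjecture.Cruxes.NearExtremalKappaCapture.Ideator2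

open Literature.Geometry.Lorentzian

/-! ## Card `polynomial-in-polynomial-out` -/

/-- **First lemma (quantitative Newton–Kantorovich, right-inverse form).** If `Φ : E → F` between
Banach spaces has `Φ 0 = 0`, derivative `Φ'` that is `B`-Lipschitz on the unit ball, and `Φ' 0` has a
bounded RIGHT inverse `L` of norm `≤ Λ`, then `Φ u = f` is solvable for every `‖f‖ ≤ 1/(4BΛ² + 2Λ)` with
`‖u‖ ≤ 2Λ‖f‖`: the basin is an explicit inverse POLYNOMIAL of the linear constant `Λ` and the modulus is
linear in `Λ`. (Chord iteration `g ↦ g − (Φ(Lg) − f)` on the ball of radius `1/(2BΛ² + Λ)` in `F`.)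
This is the certified core of "polynomial in ⇒ polynomial out"; the Nash–Moser analogue with fixed tame
loss (Saint-Raymond 1989) is the crux-planner's stub. -/
theorem firstLemma_newtonKantorovich
    {E F : Type*} [NormedAddCommGroup E] [NormedSpace ℝ E] [CompleteSpace E]
    [NormedAddCommGroup F] [NormedSpace ℝ F] [CompleteSpace F]
    (Φ : E → F) (Φ' : E → E →L[ℝ] F) (L : F →L[ℝ] E) {Λ B : ℝ} (hΛ : 0 < Λ) (hB : 0 < B)
    (hderiv : ∀ x ∈ Metric.closedBall (0 : E) 1, HasFDerivAt Φ (Φ' x) x)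
    (hlip : ∀ x ∈ Metric.closedBall (0 : E) 1, ∀ y ∈ Metric.closedBall (0 : E) 1,
      ‖Φ' x - Φ' y‖ ≤ B * ‖x - y‖)
    (hright : (Φ' 0).comp L = ContinuousLinearMap.id ℝ F) (hL : ‖L‖ ≤ Λ) (h0 : Φ 0 = 0) :
    ∀ f : F, ‖f‖ ≤ 1 / (4 * B * Λ ^ 2 + 2 * Λ) → ∃ u : E, Φ u = f ∧ ‖u‖ ≤ 2 * Λ * ‖f‖ := by
  intro f hf
  -- the radius of the ball in `F` on which the chord map contracts
  set ρ : ℝ := 1 / (2 * B * Λ ^ 2 + Λ) with hρ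
  have hden : 0 < 2 * B * Λ ^ 2 + Λ := by positivity
  have hρpos : 0 < ρ := by rw [hρ]; positivity
  have hρmul : ρ * (2 * B * Λ ^ 2 + Λ) = 1 := by rw [hρ]; field_simp
  have hρΛ : Λ * ρ ≤ 1 := by nlinarith [mul_pos hB (pow_pos hΛ 2)]
  have hρB : B * Λ ^ 2 * ρ ≤ 1 / 2 := by nlinarith
  have hf' : ‖f‖ ≤ ρ / 2 := by
    have h2 : 1 / (4 * B * Λ ^ 2 + 2 * Λ) = ρ / 2 := by
      rw [hρ]; field_simp; ring
    rw [h2] at hf; exact hf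
  -- the chord map and the ball
  set T : F → F := fun g ↦ g - (Φ (L g) - f) with hT
  set s : Set F := Metric.closedBall (0 : F) ρ with hs
  have hmem : ∀ g : F, g ∈ s ↔ ‖g‖ ≤ ρ := fun g ↦ by
    simp [hs, Metric.mem_closedBall, dist_zero_right]
  have h0s : (0 : F) ∈ s := (hmem 0).2 (by simpa using hρpos.le)
  -- `L` maps `s` into the unit ball of `E`
  have hLg : ∀ g ∈ s, ‖L g‖ ≤ Λ * ρ := fun g hg ↦
    calc ‖L g‖ ≤ ‖L‖ * ‖g‖ := L.le_opNorm g
      _ ≤ Λ * ρ := mul_le_mul hL ((hmem g).1 hg) (norm_nonneg _) hΛ.le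
  have hLball : ∀ g ∈ s, L g ∈ Metric.closedBall (0 : E) 1 := fun g hg ↦ by
    rw [Metric.mem_closedBall, dist_zero_right]
    exact (hLg g hg).trans hρΛ
  -- derivative of `G g = Φ (L g) - g` and its bound `≤ 1/2` on `s`
  have hGderiv : ∀ g ∈ s,
      HasFDerivAt (fun g : F ↦ Φ (L g) - g) ((Φ' (L g) - Φ' 0).comp L) g := by
    intro g hg
    have h1 : HasFDerivAt (fun g : F ↦ Φ (L g)) ((Φ' (L g)).comp L) g :=
      (hderiv (L g) (hLball g hg)).comp g L.hasFDerivAt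
    have h3 := h1.sub (hasFDerivAt_id g)
    have heq : (Φ' (L g)).comp L - ContinuousLinearMap.id ℝ F = (Φ' (L g) - Φ' 0).comp L := by
      rw [ContinuousLinearMap.sub_comp, hright]
    rw [heq] at h3
    exact h3
  have hGbound : ∀ g ∈ s, ‖(Φ' (L g) - Φ' 0).comp L‖ ≤ 1 / 2 := by
    intro g hg
    have h0E : (0 : E) ∈ Metric.closedBall (0 : E) 1 := by simp
    have hl : ‖Φ' (L g) - Φ' 0‖ ≤ B * ‖L g - 0‖ := hlip _ (hLball g hg) 0 h0E
    rw [sub_zero] at hl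
    calc ‖(Φ' (L g) - Φ' 0).comp L‖ ≤ ‖Φ' (L g) - Φ' 0‖ * ‖L‖ :=
          ContinuousLinearMap.opNorm_comp_le _ _
      _ ≤ (B * ‖L g‖) * Λ := mul_le_mul hl hL (norm_nonneg _) (by positivity)
      _ ≤ (B * (Λ * ρ)) * Λ := by gcongr; exact hLg g hg
      _ = B * Λ ^ 2 * ρ := by ring
      _ ≤ 1 / 2 := hρB
  -- mean value inequality on the convex set `s`
  have hconv : Convex ℝ s := convex_closedBall _ _
  have hMV : ∀ x ∈ s, ∀ y ∈ s, ‖(Φ (L x) - x) - (Φ (L y) - y)‖ ≤ 1 / 2 * ‖x - y‖ := by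
    intro x hx y hy
    exact hconv.norm_image_sub_le_of_norm_hasFDerivWithin_le (f := fun g : F ↦ Φ (L g) - g)
      (fun g hg ↦ (hGderiv g hg).hasFDerivWithinAt) hGbound hy hx
  -- `T` contracts by `1/2` on `s` and maps `s` into itself
  have hT0 : T 0 = f := by simp [hT, h0]
  have hTdiff : ∀ x ∈ s, ∀ y ∈ s, ‖T x - T y‖ ≤ 1 / 2 * ‖x - y‖ := by
    intro x hx y hy
    have h := hMV x hx y hy
    have heq : T x - T y = -((Φ (L x) - x) - (Φ (L y) - y)) := by
      simp only [hT]; abel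
    rw [heq, norm_neg]; exact h
  have hTg : ∀ g ∈ s, ‖T g‖ ≤ 1 / 2 * ‖g‖ + ‖f‖ := by
    intro g hg
    have h1 := hTdiff g hg 0 h0s
    rw [hT0, sub_zero] at h1
    have h2 := norm_add_le (T g - f) f
    rw [sub_add_cancel] at h2
    linarith
  have hmaps : Set.MapsTo T s s := by
    intro g hg
    have hg' := (hmem g).1 hg
    exact (hmem (T g)).2 (by linarith [hTg g hg])
  -- Banach fixed point on the complete set `s`
  have hsc : IsComplete s := Metric.isClosed_closedBall.isComplete
  have hK : ((2⁻¹ : NNReal) : ℝ) = 1 / 2 := by norm_num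
  have hcontr : ContractingWith (2⁻¹ : NNReal) (hmaps.restrict T s s) := by
    refine ⟨by norm_num, LipschitzWith.of_dist_le_mul fun x y ↦ ?_⟩
    rw [hK, Subtype.dist_eq, Subtype.dist_eq, dist_eq_norm, dist_eq_norm]
    simp only [MapsTo.val_restrict_apply]
    exact hTdiff x x.2 y y.2
  obtain ⟨g, hgs, hfix, -⟩ :=
    hcontr.exists_fixedPoint' hsc hmaps h0s (edist_ne_top _ _)
  -- read off the solution
  have hsol : Φ (L g) = f := by
    have h : T g = g := hfix.eq
    have h' : g - (Φ (L g) - f) = g := h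
    have h'' : Φ (L g) - f = 0 := by
      have := congrArg (fun z ↦ g - z) h'
      simpa using this
    exact sub_eq_zero.1 h''
  have hgnorm : ‖g‖ ≤ 2 * ‖f‖ := by
    have h1 := hTg g hgs
    rw [hfix.eq] at h1
    linarith
  refine ⟨L g, hsol, ?_⟩
  calc ‖L g‖ ≤ ‖L‖ * ‖g‖ := L.le_opNorm g
    _ ≤ Λ * (2 * ‖f‖) := mul_le_mul hL hgnorm (norm_nonneg _) hΛ.le
    _ = 2 * Λ * ‖f‖ := by ring

/-- Exponent bookkeeping behind the card: if the linear constant degenerates polynomially,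
`Λ ≤ C κ^{-N}` with `κ ∈ (0, 1]`, `C ≥ 1`, then the Newton–Kantorovich basin `1/(4BΛ² + 2Λ)` is bounded
below by `c κ^{2N}` with `c = 1/((4B + 2) C²)` — powers compose, nothing exponentiates. -/
theorem basin_exponent_compose {Λ C B κ : ℝ} {N : ℕ} (hB : 0 < B) (hC : 1 ≤ C) (hκ : 0 < κ)
    (hκ1 : κ ≤ 1) (hΛpos : 0 < Λ) (hΛ : Λ ≤ C * κ⁻¹ ^ N) :
    1 / ((4 * B + 2) * C ^ 2) * κ ^ (2 * N) ≤ 1 / (4 * B * Λ ^ 2 + 2 * Λ) := by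
  have hκN : 0 < κ ^ N := pow_pos hκ N
  have hone : 1 ≤ κ⁻¹ ^ N := by
    rw [inv_pow]
    exact one_le_inv_iff₀.mpr ⟨hκN, pow_le_one₀ hκ.le hκ1⟩
  have hCk1 : 1 ≤ C * κ⁻¹ ^ N := by nlinarith
  have hΛ2 : Λ ^ 2 ≤ (C * κ⁻¹ ^ N) ^ 2 := pow_le_pow_left₀ hΛpos.le hΛ 2
  have hΛ1 : Λ ≤ (C * κ⁻¹ ^ N) ^ 2 := by nlinarith
  have hden : 4 * B * Λ ^ 2 + 2 * Λ ≤ (4 * B + 2) * (C * κ⁻¹ ^ N) ^ 2 := by nlinarith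
  have hdenpos : 0 < 4 * B * Λ ^ 2 + 2 * Λ := by positivity
  have hX2 : (C * κ⁻¹ ^ N) ^ 2 * κ ^ (2 * N) = C ^ 2 := by
    rw [pow_mul']
    have h1 : κ⁻¹ ^ N * κ ^ N = 1 := by rw [inv_pow]; exact inv_mul_cancel₀ hκN.ne'
    calc (C * κ⁻¹ ^ N) ^ 2 * (κ ^ N) ^ 2 = C ^ 2 * (κ⁻¹ ^ N * κ ^ N) ^ 2 := by ring
      _ = C ^ 2 := by rw [h1]; ring
  have hk2 : 0 < κ ^ (2 * N) := pow_pos hκ _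
  have hpos1 : 0 < (4 * B + 2) * C ^ 2 := by positivity
  rw [div_mul_eq_mul_div, one_mul, div_le_div_iff₀ hpos1 hdenpos]
  calc κ ^ (2 * N) * (4 * B * Λ ^ 2 + 2 * Λ)
      ≤ κ ^ (2 * N) * ((4 * B + 2) * (C * κ⁻¹ ^ N) ^ 2) := mul_le_mul_of_nonneg_left hden hk2.le
    _ = (4 * B + 2) * ((C * κ⁻¹ ^ N) ^ 2 * κ ^ (2 * N)) := by ring
    _ = 1 * ((4 * B + 2) * C ^ 2) := by rw [hX2]; ring

/-! ## Card `area-buys-margin` -/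

/-- **The extremality margin is monotone.** For a nondecreasing nonnegative "area" `A` (Hawking /
Chruściel–Delay–Galloway–Howard: tree `EventHorizonArea.monotone_horizonArea`) and a nonincreasing
positive "Bondi mass" `m` (Bondi mass loss), the combination `μ = A/(8π m) − m` is nondecreasing.
Both arrows of dissipation point AWAY from extremality. -/
theorem margin_monotone {A m : ℝ → ℝ} (hA : Monotone A) (hm : Antitone m)
    (hApos : ∀ t, 0 ≤ A t) (hmpos : ∀ t, 0 < m t) :
    Monotone (fun t ↦ A t / (8 * Real.pi * m t) - m t) := by
  intro s t hst
  have h8 : ∀ t, 0 < 8 * Real.pi * m t := fun t ↦ by have := hmpos t; positivity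
  have h1 : A s / (8 * Real.pi * m s) ≤ A t / (8 * Real.pi * m s) :=
    div_le_div_of_nonneg_right (hA hst) (h8 s).le
  have h2 : A t / (8 * Real.pi * m s) ≤ A t / (8 * Real.pi * m t) := by
    apply div_le_div_of_nonneg_left (hApos t) (h8 t)
    nlinarith [hm hst, Real.pi_pos]
  have h3 : m t ≤ m s := hm hst
  dsimp only
  linarith

/-- **At a Kerr end state the margin is the extremality gap**: `A = 8π M' r₊(M', a')` gives
`A/(8πM') − M' = √(M'² − a'²)` (`= 2 M' r₊ κ'` by `Kerr.surfaceGravity_eq_div_two_mul_rPlus`). -/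
theorem margin_at_kerr {M' a' : ℝ} (hM' : 0 < M') :
    8 * Real.pi * M' * Kerr.rPlus M' a' / (8 * Real.pi * M') - M' = √(M' ^ 2 - a' ^ 2) := by
  unfold Kerr.rPlus
  have : (8 : ℝ) * Real.pi * M' ≠ 0 := by positivity
  field_simp
  ring

/-- **First lemma (area pins the temperature).** Elementary consequence of the two laws: if the
initial horizon cross-section has area within `err` of the Kerr value `8πM r₊(M, a)`, the initial Bondi
mass exceeds `M` by at most `err/(8πM)`, the area never decreases and the mass never increases, and the
end state is Kerr `(M', a')`, then for `err ≤ π M² √(1 − (a/M)²)` — a basin of size `≍ M²√χ` in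
AREA-DEFICIT / MASS-EXCESS units, which is `≍ M χ` in data norm because the horizon area responds to data
with the factor `∂r₊/∂M = r₊/√(M² − a²) ≍ χ^{-1/2}` (exponent `γ_χ = 1`, the refuter's necessary exponent,
hence sharp) — the end state is SUB-extremal with gap `√(M'² − a'²) ≥ M√(1 − (a/M)²)/4`, i.e. `κ' ≳ κ`:
the near-extremal hole cannot be pushed to (or past) extremality, and the modulated background never
drifts to the degenerate end during the evolution. PROVED (the hypothesis `|a'| ≤ M'` turned out to be
unnecessary: `Kerr.rPlus` carries `Real.sqrt`). -/
theorem firstLemma_areaPinsTemperature {M a M' a' A₀ A_f M_B0 err : ℝ}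
    (hM : 0 < M) (ha : |a| < M)
    (hA : A₀ ≤ A_f)                                   -- second law along 𝓗⁺
    (hMB : M' ≤ M_B0) (hM' : 0 < M')                  -- Bondi mass loss, final mass
    (hfinal : A_f = 8 * Real.pi * M' * Kerr.rPlus M' a')                      -- end state Kerr(M',a')
    (hinit : 8 * Real.pi * M * Kerr.rPlus M a - err ≤ A₀)                   -- initial area
    (hMB0 : M_B0 ≤ M + err / (8 * Real.pi * M)) (herr0 : 0 ≤ err)            -- initial mass
    (herr : err ≤ Real.pi * M ^ 2 * √(1 - (a / M) ^ 2)) :                      -- basin ≍ M²√χ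
    Kerr.IsSubextremal M' a' ∧ M * √(1 - (a / M) ^ 2) / 4 ≤ √(M' ^ 2 - a' ^ 2) := by
  -- notation: S = √(1 − (a/M)²) ∈ (0, 1], s' = √(M'² − a'²) ≥ 0, η = err/(8πM)
  set S : ℝ := √(1 - (a / M) ^ 2) with hSdef
  set s' : ℝ := √(M' ^ 2 - a' ^ 2) with hs'def
  have hπ : 0 < Real.pi := Real.pi_pos
  have haM : (a / M) ^ 2 < 1 := by
    have h1 : |a / M| < 1 := by rw [abs_div, abs_of_pos hM, div_lt_one hM]; exact ha
    have h2 : 0 ≤ |a / M| := abs_nonneg _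
    calc (a / M) ^ 2 = |a / M| ^ 2 := (sq_abs _).symm
      _ < 1 := by nlinarith
  have hSpos : 0 < S := Real.sqrt_pos.mpr (by linarith)
  have hSle : S ≤ 1 := Real.sqrt_le_one.mpr (by nlinarith [sq_nonneg (a / M)])
  have hs'nn : 0 ≤ s' := Real.sqrt_nonneg _
  -- r₊(M,a) = M + M S and r₊(M',a') = M' + s'
  have hrp : Kerr.rPlus M a = M + M * S := by
    unfold Kerr.rPlus; rw [hSdef, Kerr.sqrt_one_sub_div_sq hM a]; field_simp
  have hrp' : Kerr.rPlus M' a' = M' + s' := by unfold Kerr.rPlus; rfl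
  rw [hrp] at hinit
  rw [hrp'] at hfinal
  -- η := err/(8πM): 0 ≤ η ≤ M S / 8, and 8πMη = err
  set η : ℝ := err / (8 * Real.pi * M) with hηdef
  have h8M : 0 < 8 * Real.pi * M := by positivity
  have hηnn : 0 ≤ η := div_nonneg herr0 h8M.le
  have hηerr : 8 * Real.pi * M * η = err := by rw [hηdef]; field_simp
  have hηle : η ≤ M * S / 8 := by
    rw [hηdef, div_le_iff₀ h8M]; nlinarith
  -- the chain 8πM(M + MS) − err ≤ A₀ ≤ A_f = 8πM'(M' + s')
  have hchain : 8 * Real.pi * M * (M + M * S) - err ≤ 8 * Real.pi * M' * (M' + s') := by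
    have h := hinit.trans (hA.trans hfinal.le); exact h
  have hM'le : M' ≤ M + η := hMB.trans hMB0
  have hM'sq : M' ^ 2 ≤ (M + η) ^ 2 := pow_le_pow_left₀ hM'.le hM'le 2
  have h8sq : 8 * Real.pi * M' ^ 2 ≤ 8 * Real.pi * M ^ 2 + 2 * err + 8 * Real.pi * η ^ 2 := by
    have h := mul_le_mul_of_nonneg_left hM'sq (by positivity : (0 : ℝ) ≤ 8 * Real.pi)
    have hexp : 8 * Real.pi * (M + η) ^ 2 = 8 * Real.pi * M ^ 2 + 2 * (8 * Real.pi * M * η) +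
        8 * Real.pi * η ^ 2 := by ring
    rw [hexp, hηerr] at h
    exact h
  -- 8π M' s' ≥ 8π M² S − 3 err − 8π η²
  have hkey : 8 * Real.pi * M ^ 2 * S - 3 * err - 8 * Real.pi * η ^ 2 ≤ 8 * Real.pi * M' * s' := by
    have hc : 8 * Real.pi * M * (M + M * S) - err =
        8 * Real.pi * M ^ 2 + 8 * Real.pi * M ^ 2 * S - err := by ring
    have hd : 8 * Real.pi * M' * (M' + s') = 8 * Real.pi * M' ^ 2 + 8 * Real.pi * M' * s' := by ring
    rw [hc, hd] at hchain
    linarith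
  -- 8π η² ≤ π M² S / 8 and 3 err ≤ 3 π M² S, whence the lower bound (39/8) π M² S ≤ 8π M' s'
  have hη2 : η ^ 2 ≤ (M * S / 8) ^ 2 := pow_le_pow_left₀ hηnn hηle 2
  have hSS : S ^ 2 ≤ S := by nlinarith
  have hη2' : 8 * Real.pi * η ^ 2 ≤ Real.pi * M ^ 2 * S / 8 := by
    have h1 : 8 * Real.pi * η ^ 2 ≤ 8 * Real.pi * (M * S / 8) ^ 2 :=
      mul_le_mul_of_nonneg_left hη2 (by positivity)
    have h2 : 8 * Real.pi * (M * S / 8) ^ 2 = Real.pi * M ^ 2 * S ^ 2 / 8 := by ring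
    have h3 : Real.pi * M ^ 2 * S ^ 2 / 8 ≤ Real.pi * M ^ 2 * S / 8 := by
      have : 0 ≤ Real.pi * M ^ 2 / 8 := by positivity
      nlinarith
    linarith
  have hlow : Real.pi * M ^ 2 * S * (39 / 8) ≤ 8 * Real.pi * M' * s' := by linarith
  -- M' ≤ 9M/8
  have hMS : M * S ≤ M := mul_le_of_le_one_right hM.le hSle
  have hM'up : M' ≤ 9 * M / 8 := by linarith
  -- conclusion s' ≥ M S / 4 by contradiction
  have hPMS : 0 < Real.pi * M ^ 2 * S := by positivity
  have hgoal : M * S / 4 ≤ s' := by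
    by_contra hcon
    have hcon' : s' < M * S / 4 := lt_of_not_ge hcon
    have h1 : M' * s' ≤ 9 * M / 8 * s' := mul_le_mul_of_nonneg_right hM'up hs'nn
    have h2 : 9 * M / 8 * s' < 9 * M / 8 * (M * S / 4) := mul_lt_mul_of_pos_left hcon' (by positivity)
    have h3 : M' * s' < 9 * M / 8 * (M * S / 4) := h1.trans_lt h2
    have h4 : 8 * Real.pi * (M' * s') < 8 * Real.pi * (9 * M / 8 * (M * S / 4)) :=
      mul_lt_mul_of_pos_left h3 (by positivity)
    have h5 : 8 * Real.pi * (9 * M / 8 * (M * S / 4)) = Real.pi * M ^ 2 * S * (9 / 4) := by ring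
    have h6 : 8 * Real.pi * (M' * s') = 8 * Real.pi * M' * s' := by ring
    rw [h5, h6] at h4
    linarith
  have hs'pos : 0 < s' := by
    have : 0 < M * S / 4 := by positivity
    linarith
  refine ⟨?_, hgoal⟩
  -- s' > 0 ⇒ a'² < M'² ⇒ |a'| < M'
  have hsq : 0 < M' ^ 2 - a' ^ 2 := Real.sqrt_pos.mp hs'pos
  unfold Kerr.IsSubextremal
  exact abs_lt_of_sq_lt_sq (by linarith) hM'.le

/-! ## Card `temperature-is-gauge-in-the-throat` -/

/-- **Zoom–temperature covariance, exact on the Kerr family.** Zooming into the event horizon at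
scale `ε` (`r = r₊ + ε x`) turns `Δ = (r − r₊)(r − r₋)` into `ε² x (x + 2T̃)` with dimensionless throat
temperature `T̃ = (r₊ − r₋)/(2ε) = √(M² − a²)/ε`: depth of zoom and temperature trade off exactly, before
any limit. `ε = r₊ − r₋` is the unit-temperature near-NHEK normal form; `ε = 2^{-k}M`, `k ≤ log₂(1/κM)`,
are the dyadic self-similar shells of the card. -/
theorem delta_zoom {M a : ℝ} (h : |a| ≤ M) {ε : ℝ} (hε : ε ≠ 0) (x : ℝ) :
    Kerr.delta M a (Kerr.rPlus M a + ε * x) =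
      ε ^ 2 * (x * (x + (Kerr.rPlus M a - Kerr.rMinus M a) / ε)) := by
  rw [Kerr.delta_eq_mul h]
  field_simp
  ring

/-- **Temperature is a gauge in the throat.** The near-NHEK radial coefficient `x(x + 2T)` (so that
`ds² ∝ −x(x+2T)dt̂² + dx²/(x(x+2T)) + dθ² + Λ(θ)²(dφ̂ + (x + T)dt̂)²`, Bredberg–Hartman–Song–Strominger
arXiv:0907.3477 (2.6)) and the frame-dragging coefficient `x + T` are homogeneous under
`(x, T) ↦ (λx, λT)` of degrees `2` and `1`: with `t̂ ↦ t̂/λ` every positive temperature is mapped to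
every other. All `κ`-dependence of near-extremal dynamics is therefore generated at the MOUTH of the
throat, where thermal time `t̂ = κ t*` meets asymptotic time. -/
theorem nearNHEK_scaling (T x l : ℝ) :
    (l * x) * (l * x + 2 * (l * T)) = l ^ 2 * (x * (x + 2 * T)) ∧
      (l * x + l * T) = l * (x + T) := by
  constructor <;> ring

/-- **`γ_χ = 1` is the boost weight of curvature.** The conversion between the unit-temperature zoom
scale and the mass scale is `(r₊ − r₋)² = 4M²(1 − (a/M)²)`: a perturbation of Kerr–Schild size `ε` has
throat-frame size `≲ ε · (M/(r₊ − r₋))²` in its boost-weight-2 components, so throat-frame smallness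
`ε (M/(r₊−r₋))² ≤ c₀` is exactly `ε ≤ 4c₀ (1 − (a/M)²)` — the basin exponent `γ = 1` in `χ = 1 − (a/M)²`,
matching the refuter's necessary exponent (exterior-truncated lighter Kerr members). -/
theorem gamma_is_boost_weight {M a : ℝ} (hM : 0 < M) (h : |a| ≤ M) :
    (Kerr.rPlus M a - Kerr.rMinus M a) ^ 2 = 4 * M ^ 2 * (1 - (a / M) ^ 2) := by
  rw [Kerr.rPlus_sub_rMinus]
  have ha : a ^ 2 ≤ M ^ 2 := by nlinarith [sq_abs a, abs_nonneg a]
  have hs : √(M ^ 2 - a ^ 2) ^ 2 = M ^ 2 - a ^ 2 := Real.sq_sqrt (sub_nonneg.2 ha)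
  have hM0 : M ≠ 0 := hM.ne'
  field_simp
  nlinarith [hs]

/-! ## The crux, by name (what every line must conclude) -/

/-- The target of all three cards is the route decl itself (no restatement). -/
example : Prop := Summit.FinalStateConjecture.FinalStateConjecture.Theses.PhaseMixingCapture.NearExtremalKappaCapture

end Summit.FinalStateConjecture.FinalStateConjecture.Cruxes.NearExtremalKappaCapture.Ideator2
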